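import Literature.MathematicalPhysics.QuantumFieldTheory.Balaban1983to89.B2Ineq329RegularField

/-!
# `Balaban1983to89.B2Prop31RegularFamily` — [Balaban1982Higgs2] Proposition 3.1 (3.26) p. 589 and (3.29) p. 590: the cell's
TYPED DECLS OF RECORD `B2.Prop31Printed` AND `B2.Ineq329Printed` INHABITED ON BAŁABAN'S OWN CARRIER WITH A GENERAL VECTOR
FIELD `Ã^ε` — the concrete multiscale instances `RMulti` (the tori `T⁽ᵏ⁾_{Lᵏε}`, nested regions of (3.24), charge data, a vector
field `Ã^ε`, a configuration `Φ`, moduli `δ_k`, `Ψ_k` of the restrictions), the families `regP31Fam : RMulti → B2.P31Setting`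
(`form = ⟨Φ, Δ(Ã^ε)Φ⟩ = form325`, `zeroField := Ã^ε = 0`, `restricted :=` the explicit reading below) and `reg329Fam : (Σ i, Fin i.K)
→ B2.I329Setting`, and the two theorems **`prop31Printed_regular : B2.Prop31Printed Q (regP31Fam Q m² M)`** (BOTH conjuncts: the
restricted clause from `B2Ineq329RegularField.prop31_regular_concrete` with error `Σ_{k=1}^{K} γ₀M(Lᵏε)^{κ₀}|Λ_k|`, the zero-field
clause from p15's `B2Prop31ZeroFieldConcrete.prop31_zeroField_concrete`) and **`ineq329Printed_regular : B2.Ineq329Printed Q.κ₀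
(reg329Fam Q m² M)`**, one constant `γ₀ = min(a(1 − L⁻²)/(8d + 2m² + 4), 1/16) > 0` for the whole family

statement-level skeleton of published theorems with citation tags; proofs where landed; nothing here is a claim about the Yang–Mills mass gap

CITATION HEADER.  T. Bałaban, *(Higgs)₂,₃ quantum fields in a finite volume. II. An upper bound*, Commun. Math. Phys. **86**
(1982) 555–594 [Balaban1982Higgs2], Prop. 3.1 (3.26) p. 589, (3.29) p. 590 (PDF held `paper:balaban1982-cmp86-higgs23-ii`; pp.
589–590 [PDF 35–36] READ AS IMAGES on the ×2 renders `run/shared/lean/pub/pub-balaban/b2b-balaban-ref1/pages/1982-cmp86-higgs23-II/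
1982-cmp86-higgs23-II-p035-x2.png`, `-p036-x2.png`).  Cell `lit-balaban` (HOME `run/shared/lean/pub/lit-balaban/`), Phase-2 proof
seat **p23** gen 9 (unit `lit-balaban-p23-g9`), third file of the gen after `B2Ineq329RegularField` (p305722) and
`B2Ineq330RegularFieldConcrete` (p306029).  SKELETON rows **B2.Prop3.1** (decl of record `B2.Prop31Printed`; owner r02, second reader
r14, referee ref-4) and **B2.Eq3.29** (`B2.Ineq329Printed`).  PRECEDENTS, BY NAME, NOT RESTATED: r14's zero-field families
`B2Prop31ZeroField.{zeroP31Fam, prop31Printed_zeroField, zero329Fam, ineq329Printed_zeroField}` (ℤ^{d+1} carriers, `restricted := True`,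
`zeroField := True`, `C = 0`) and `B2Prop31ZeroFieldModel.prop31Printed_zeroField_model` (p252013); b2b's `B2.P31Setting`,
`B2.I329Setting`, `B2.Params` (the model constants `L, d, a, κ₀`).

WHAT IS PRINTED.  p. 589 [PDF 35]: *"**Proposition 3.1.** There exists a constant γ₀ > 0 dependent on the space dimension d and
the constant a only, and independent of ε and a choice of the sets Λ₅⁽⁰⁾, …, Λ₅⁽ᴷ⁻¹⁾, such that for arbitrary configurations Ã^ε, Φ
defined by the formulas (3.2), (3.3), (3.24), and satisfying the restrictions given by the characteristic functions in (3.21), the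
following inequality holds ⟨Φ, Δ(Ã^ε)Φ⟩ ≥ γ₀ Σ_{k=0}^{K} Σ_{⟨x,x′⟩⊂Λ₅⁽ᵏ⁻¹⁾′∩Λ₅⁽ᵏ⁾ᶜ} (Lᵏε)^{d−2}|U(Ã^ε(⟨x,x′⟩))φ_k(x′) − φ_k(x)|² +
γ₀ Σ_{k=0}^{K} Σ_{x∈Λ₅⁽ᵏ⁻¹⁾′∩Λ₅⁽ᵏ⁾ᶜ} (Lᵏε)^d m²|φ_k(x)|² − Σ_{k=1}^{K} O((Lᵏε)^{κ₀})|(Λ₅⁽ᵏ⁻¹⁾′∩Λ₅⁽ᵏ⁾ᶜ)₁|, (3.26) with κ₀ > 0. … We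
assume m² ≤ O(1) also. If Ã^ε = 0, then the inequality holds without the last sum on the right side and without any restrictions
on the configuration Φ."*; p. 590 [PDF 36]: (3.29) *"with a constant γ₀ independent of k, Λ_k and for φ′_k, Ã^η satisfying
suitable restrictions"* (full quotes in `B2Ineq329RegularField`).

DICTIONARY (print ↦ Lean).  An instance of (3.26) ↦ `i : RMulti Q m² M` (model constants from `Q : B2.Params`: `i.P.L = Q.L`,
`i.P.d = Q.d`, `a = Q.a`, `κ₀ = Q.κ₀`); `⟨Φ, Δ(Ã^ε)Φ⟩` ↦ `form325 i.R i.C Q.a i.A m² i.Φ` ((3.25), p252464); `⟨Φ, Δ′(Ã^ε)Φ⟩` ↦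
`form325N` ((3.27), p254057); the k-th term of (3.28) ↦ `outTerm`/`termForm` (p254943); the k-th bond sum ↦ `bond0` (k = 0) /
`RMulti.bondKA` (`Σ_{c⊂Λ_k}(Lᵏε)^d|(D^{Lᵏε}_{Ā⁽ᵏ⁾}φ̃_k)(c)|²`, = the printed `Σ(Lᵏε)^{d−2}|U(Ã(⟨x,x′⟩))φ_k(x′) − φ_k(x)|²` by
`B2Ineq329RegularField.bondKA_eq_sum_printed`, with the coarse bond variable `Lᵏε Ā⁽ᵏ⁾ = ε Σ_{straight}Ã` of (II.2.55)); the k-th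
mass sum ↦ `mass0` / p15's `massK`; `|(Λ₅⁽ᵏ⁻¹⁾′∩Λ₅⁽ᵏ⁾ᶜ)₁|` ↦ `RMulti.vol k = |Λ_k|`; «Ã^ε = 0» ↦ `zeroField := i.A = 0`;
«satisfying the restrictions given by the characteristic functions in (3.21)» ↦ `RMulti.restricted` := (`δ_k ≥ 0`) ∧ (`Ã^ε`
`δ_k`-regular on `Bᵏ(Λ_k)`: `|Ã(⟨z+εe_ν,·⟩) − Ã(⟨z,·⟩)| ≤ δ_k`, [B4] (1.21) in lattice units) ∧ (smallness
`8d⁴L^d e²(Lᵏε)²(Lᵏδ_k)² ≤ ½`, «e sufficiently small») ∧ (`|φ_k(y)| ≤ Ψ_k` on `Λ_k`) ∧ (exponent bookkeeping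
`64d³e²(Lᵏδ_k)²Ψ_k²(Lᵏε)^d ≤ M(Lᵏε)^{κ₀}`, i.e. pub-balaban GAPS G-pv07-1 (ii)'s `hAbs`) — an EXPLICIT READING of the printed
restrictions, not their derivation from (3.21); the rescaling p. 590 `φ′_k = (Lᵏε)^{(d−2)/2}φ_k` ↦ `reg329Fam.l2sq = (Lᵏε)⁻²Σ(Lᵏε)^d|φ_k|²`
(= `Σ|φ′_k|²`) and `covDiffSq = bondKA` (= `Σ|U φ′_k(y′) − φ′_k(y)|²`).

WHAT THIS MODULE PROVES (kernel-checked, 0 `sorry`, standard axioms; carrier defs `RMulti`, `RMulti.{restricted, bondKA, errK, vol}`,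
`regP31Fam`, `reg329Fam` with bodies; no `Prop`-valued fact).  §1 `bondKA_zero` (at `Ã = 0` the covariant bond sum is p15's `bondK`),
`gamma0_regular_le_gamma0` (the regular-field `γ₀` is below p15's zero-field `gamma0`); §2 the carriers, `RMulti.vol_succ`; §3
**`prop31Printed_regular`** (`Q.L > 1`, `Q.a > 0`, `Q.d ≥ 1`, `m² > 0`, `M ≥ 0`; `γ₀ = min(Q.a(1 − Q.L⁻²)/(8Q.d + 2m² + 4), 1/16)`,
`C = γ₀M`; restricted clause by `prop31_regular_concrete`, zero-field clause by `prop31_zeroField_concrete` and `γ₀ ≤ gamma0`);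
§4 **`ineq329Printed_regular`** (`m² ≥ 0`; per scale, from `ineq329_regular_concrete` + `l2_le_of_sup`).
HONEST SCOPE.  (i) `restricted` is OUR explicit reading (regularity moduli `δ_k`, sup-bounds `Ψ_k`, smallness, exponent
bookkeeping with modulus `M`); that the characteristic functions of (3.21) imply it for Bałaban's runs — and with which `M`,
uniformly — is NOT proved here (rows B2.Eq3.21/3.31; pub-balaban G-pv07-1 (ii)).  (ii) `γ₀` depends on `d`, `a` AND on `L`
(through `a_∞ = a(1 − L⁻²)`) and the bound `m²` — as in the zero-field precedents (cell GAPS, Prop. 3.1 (vii)/(viii)); the print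
says «d and the constant a only» under «m² ≤ O(1)».  (iii) `m² > 0` is needed for the carrier's `form325` (fibre minimum); the
family fixes `m²` and `M` as parameters next to `Q`.  (iv) [B4]'s `e^{2−α}` sharpening is not used: the error constant is
`C = γ₀M` with the `e²`-type bookkeeping of (i).
-/

noncomputable section

open MeasureTheory Finset Real
open scoped BigOperators ENNReal InnerProductSpace

namespace Literature.MathematicalPhysics.QuantumFieldTheory.Balaban1983to89.B2Prop31RegularFamily

open Literature.MathematicalPhysics.QuantumFieldTheory.Balaban1983to89.HiggsLattice
open Literature.MathematicalPhysics.QuantumFieldTheory.Balaban1983to89.HiggsAveraging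
open Literature.MathematicalPhysics.QuantumFieldTheory.Balaban1983to89.HiggsCovariance
open Literature.MathematicalPhysics.QuantumFieldTheory.Balaban1983to89.HiggsCovariancePos
open Literature.MathematicalPhysics.QuantumFieldTheory.Balaban1983to89.B2Eq337ScalarIntegration
open Literature.MathematicalPhysics.QuantumFieldTheory.Balaban1983to89.B2Eq325ConcreteSchur
open Literature.MathematicalPhysics.QuantumFieldTheory.Balaban1983to89.B2Ineq327ConcreteNeumann
open Literature.MathematicalPhysics.QuantumFieldTheory.Balaban1983to89.B2Eq328ConcretePieces
open Literature.MathematicalPhysics.QuantumFieldTheory.Balaban1983to89.B2Eq328DeltaK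
open Literature.MathematicalPhysics.QuantumFieldTheory.Balaban1983to89.B2Ineq329ZeroAveraging
open Literature.MathematicalPhysics.QuantumFieldTheory.Balaban1983to89.B2Prop31ZeroFieldConcrete
open Literature.MathematicalPhysics.QuantumFieldTheory.Balaban1983to89.B2Eq255Concrete (barA barA_zero)
open Literature.MathematicalPhysics.QuantumFieldTheory.Balaban1983to89.B2Ineq329RegularField

variable {P : HiggsLattice.Params} {N K : ℕ}

/-! ## §1 The k-th covariant bond sum at `Ã = 0` and the two constants `γ₀` -/

section Prelim

variable (R : Regions P K) (C : ChargeData N)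

/-- At `Ã = 0` the covariant bond sum of (3.26) is p15's zero-field bond sum `bondK` (`Ā⁽ᵏ⁾(0) = 0`, `U(0) = 1`).
[cite: Balaban1982Higgs2, Prop. 3.1 (3.26) p.589] -/
theorem bondKA_zero (j : Fin K) (ψ : LSite R j → V N) :
    (∑ c : HiggsLattice.PBond P (j.val + 1), if Inside (R.block j) c then
        P.mesh (j.val + 1) ^ P.d * ‖covDeriv C (barA (j.val + 1) (0 : HiggsLattice.VecField P 0)) (extL R j ψ) c‖ ^ 2
        else 0) = bondK R j ψ := by
  rw [bondK, barA_zero]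
  refine Finset.sum_congr rfl fun c _ => ?_
  split_ifs
  · rw [HiggsLattice.covDeriv_zero]
  · rfl

/-- The regular-field constant is below p15's zero-field constant: `min(a_∞/(8d+2m²+4), 1/16) ≤ min(a_∞/(8d+2m²), 1/4) = gamma0`
(`a_∞ = a(1 − L⁻²) > 0`). [cite: Balaban1982Higgs2, Prop. 3.1 p.589] -/
theorem gamma0_regular_le_gamma0 {a msq : ℝ} (ha : 0 < a) (hL : 1 < P.L) (hmsq : 0 ≤ msq) :
    min (a * (1 - ((P.L : ℝ) ^ 2)⁻¹) / (8 * P.d + 2 * msq + 4)) (1 / 16) ≤ gamma0 P a msq := by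
  have hL' : (1 : ℝ) < P.L := by exact_mod_cast hL
  have hd : (1 : ℝ) ≤ P.d := by exact_mod_cast P.hd
  have hainf0 : 0 < a * (1 - ((P.L : ℝ) ^ 2)⁻¹) := by
    have h1 : (1 : ℝ) < (P.L : ℝ) ^ 2 := by nlinarith
    have : ((P.L : ℝ) ^ 2)⁻¹ < 1 := inv_lt_one_of_one_lt₀ h1
    exact mul_pos ha (by linarith)
  have hB : 0 < 8 * (P.d : ℝ) + 2 * msq := by linarith
  unfold gamma0
  refine le_min ?_ ((min_le_right _ _).trans (by norm_num))
  refine (min_le_left _ _).trans ?_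
  exact div_le_div_of_nonneg_left hainf0.le hB (by linarith)

end Prelim

/-! ## §2 The concrete multiscale instances of Proposition 3.1 with a GENERAL vector field, and the family of `B2.P31Setting` -/

/-- **One concrete instance of Proposition 3.1 (3.26) on Bałaban's carrier with a general vector field** (model constants
`L := Q.L`, `d := Q.d`, `a := Q.a`, `κ₀ := Q.κ₀` of the cell's parameter record `Q : B2.Params`; mass `m²`; error
modulus `M`): a lattice family member `P` with `P.L = Q.L`, `P.d = Q.d`, the number of steps `K ≤ P.K` with `Lᴷε ≤ 1`,
nested region data `R` ((3.24)), the charge data, the vector field `Ã^ε`, the configuration `Φ` of (3.24), and the moduli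
`δ_k` (regularity of `Ã^ε` on `Bᵏ(Λ_k)`) and `Ψ_k` (sup-bounds of `φ_k` on `Λ_k`) of the restrictions.
[cite: Balaban1982Higgs2, Prop. 3.1 (3.26) p.589, (3.24) p.588] -/
structure RMulti (Q : B2.Params) (m2 M : ℝ) where
  /-- the lattice family member (tori `T^{(k)}_{Lᵏε}`) -/
  P : HiggsLattice.Params
  hL : P.L = Q.L
  hd : P.d = Q.d
  /-- number of real field components -/
  N : ℕ
  /-- number of renormalization steps, `K ≤` the number of scales, `Lᴷε ≤ 1` -/
  K : ℕ
  hK : K ≤ P.K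
  hε : P.mesh K ≤ 1
  /-- the regions of (3.24) and their nested geometry -/
  R : Regions P K
  hR : Nested R
  C : ChargeData N
  /-- the vector field `Ã^ε` -/
  A : HiggsLattice.VecField P 0
  /-- the configuration `Φ = (φ₀↾Λ₅⁽⁰⁾ᶜ, φ_k↾Λ_k)` of (3.24) -/
  Φ : Cfg R N
  /-- regularity moduli of `Ã^ε` on `Bᵏ(Λ_k)` and sup-bounds of `φ_k` on `Λ_k` -/
  δ : Fin K → ℝ
  Ψ : Fin K → ℝ

namespace RMulti

variable {Q : B2.Params} {m2 M : ℝ}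

/-- *"satisfying the restrictions given by the characteristic functions in (3.21)"*, READ AS: `Ã^ε` is `δ_k`-regular on
`Bᵏ(Λ_k)` ((1.21) of [B4] in lattice units) with the smallness `8d⁴L^d e²(Lᵏε)²(Lᵏδ_k)² ≤ ½`, `|φ_k| ≤ Ψ_k` on `Λ_k`, and the
exponent bookkeeping `64d³e²(Lᵏδ_k)²Ψ_k²(Lᵏε)^d ≤ M(Lᵏε)^{κ₀}` turning the error of `B2Ineq329RegularField` into the printed
`O((Lᵏε)^{κ₀})|Λ_k|` (pub-balaban GAPS G-pv07-1 (ii)). [cite: Balaban1982Higgs2, Prop. 3.1 p.589, (3.21) p.587, (3.29) p.590] -/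
def restricted (i : RMulti Q m2 M) : Prop :=
  (∀ j : Fin i.K, 0 ≤ i.δ j)
  ∧ (∀ (j : Fin i.K), ∀ z ∈ pieceF i.R j, ∀ μ' ν : Fin i.P.d,
      |i.A ⟨z.shift ν, μ'⟩ - i.A ⟨z, μ'⟩| ≤ i.δ j)
  ∧ (∀ j : Fin i.K, 8 * (i.P.d : ℝ) ^ 4 * (i.P.L : ℝ) ^ i.P.d * i.C.e ^ 2 * i.P.mesh (j.val + 1) ^ 2 *
      ((i.P.L : ℝ) ^ (j.val + 1)) ^ 2 * i.δ j ^ 2 ≤ 1 / 2)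
  ∧ (∀ (j : Fin i.K) (y : LSite i.R j), ‖resL i.R j i.Φ y‖ ≤ i.Ψ j)
  ∧ (∀ j : Fin i.K, 64 * (i.P.d : ℝ) ^ 3 * i.C.e ^ 2 * ((i.P.L : ℝ) ^ (j.val + 1)) ^ 2 * i.δ j ^ 2 *
      (i.Ψ j ^ 2 * i.P.mesh (j.val + 1) ^ i.P.d) ≤ M * i.P.mesh (j.val + 1) ^ Q.κ₀)

/-- The k-th covariant bond sum of (3.26), `k = j + 1`. [cite: Balaban1982Higgs2, Prop. 3.1 (3.26) p.589] -/
def bondKA (i : RMulti Q m2 M) (j : Fin i.K) : ℝ :=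
  ∑ c : HiggsLattice.PBond i.P (j.val + 1), if Inside (i.R.block j) c then
    i.P.mesh (j.val + 1) ^ i.P.d * ‖covDeriv i.C (barA (j.val + 1) i.A) (extL i.R j (resL i.R j i.Φ)) c‖ ^ 2 else 0

/-- The k-th error `64γ₀⁻¹·err_k/γ₀`-free part: `64d³e²(Lᵏδ_k)²Ψ_k²(Lᵏε)^d|Λ_k|` (to be multiplied by `γ₀`). [cite: Balaban1982Higgs2, (3.26) p.589] -/
def errK (i : RMulti Q m2 M) (j : Fin i.K) : ℝ :=
  64 * (i.P.d : ℝ) ^ 3 * i.C.e ^ 2 * ((i.P.L : ℝ) ^ (j.val + 1)) ^ 2 * i.δ j ^ 2 *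
    (i.Ψ j ^ 2 * i.P.mesh (j.val + 1) ^ i.P.d * ((i.R.block j).card : ℝ))

/-- `|(Λ₅⁽ᵏ⁻¹⁾′∩Λ₅⁽ᵏ⁾ᶜ)₁| = |Λ_k|` for `k = 1, …, K` (and `0` otherwise; the `k = 0` term of (3.26) carries no error).
[cite: Balaban1982Higgs2, Prop. 3.1 (3.26) p.589] -/
def vol (i : RMulti Q m2 M) (k : ℕ) : ℕ :=
  if h : 0 < k ∧ k - 1 < i.K then (i.R.block ⟨k - 1, h.2⟩).card else 0

/-- `vol (j+1) = |Λ_{j+1}|`. [cite: Balaban1982Higgs2, Prop. 3.1 (3.26) p.589] -/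
theorem vol_succ (i : RMulti Q m2 M) (j : Fin i.K) : i.vol (j.val + 1) = (i.R.block j).card := by
  unfold vol
  rw [dif_pos ⟨Nat.succ_pos _, by simp [j.isLt]⟩]
  congr 2

end RMulti

/-- **THE CONCRETE GENERAL-FIELD FAMILY OF `B2.P31Setting`**: `ε`, `K`, `restricted` (above), `zeroField := (Ã^ε = 0)`,
`form = ⟨Φ, Δ(Ã^ε)Φ⟩ = form325` ((3.25), p252464), `formN = ⟨Φ, Δ′(Ã^ε)Φ⟩ = form325N` ((3.27), p254057), `term k` = the k-th term
of (3.28) (`outTerm` / `termForm`, p254943), `bond k` / `mass k` = the k-th covariant bond / mass sums of (3.26) (`bond0`/`bondKA`,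
`mass0`/`massK`), `vol k = |Λ_k|`. [cite: Balaban1982Higgs2, Prop. 3.1 (3.26)–(3.28) p.589] -/
def regP31Fam (Q : B2.Params) (m2 M : ℝ) (i : RMulti Q m2 M) : B2.P31Setting where
  ε := i.P.mesh 0
  K := i.K
  restricted := i.restricted
  zeroField := i.A = 0
  form := form325 i.R i.C Q.a i.A m2 i.Φ
  formN := form325N i.R i.C Q.a i.hR.pieces i.A m2 i.Φ
  term := natExt (outTerm i.R i.C i.A m2 i.Φ.1) fun j => termForm i.R i.C Q.a i.A m2 j (resL i.R j i.Φ)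
  bond := natExt (bond0 i.R i.C i.A i.Φ.1) fun j => i.bondKA j
  mass := natExt (mass0 i.R m2 i.Φ.1) fun j => massK i.R m2 j (resL i.R j i.Φ)
  vol := i.vol

/-! ## §3 `B2.Prop31Printed` on the concrete general-field family -/

/-- `Σ_{k=1}^{K} g k = Σ_{j<K} g (j+1)`. [folklore] -/
private theorem sum_Icc_eq_sum_fin (K : ℕ) (g : ℕ → ℝ) : ∑ k ∈ Finset.Icc 1 K, g k = ∑ j : Fin K, g (j.val + 1) := by
  have h : ∑ k ∈ Finset.range (K + 1), g k = g 0 + ∑ k ∈ Finset.Icc 1 K, g k := by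
    rw [Finset.sum_range_eq_add_Ico _ (by omega : 0 < K + 1), Finset.Ico_add_one_right_eq_Icc]
  have h2 : ∑ k ∈ Finset.range (K + 1), g k = g 0 + ∑ j : Fin K, g (j.val + 1) := by
    rw [Finset.sum_range_succ', add_comm, Finset.sum_range]
  linarith

/-- **THE CELL'S TYPED PROPOSITION 3.1 `B2.Prop31Printed Q` HOLDS ON THE CONCRETE GENERAL-FIELD FAMILY** — BOTH conjuncts:
the RESTRICTED clause (error `Σ_{k=1}^{K} C(Lᵏε)^{κ₀}|Λ_k|`, `C = γ₀M`) from `B2Ineq329RegularField.prop31_regular_concrete`,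
and the ZERO-FIELD clause (*"without the last sum … and without any restrictions on the configuration Φ"*) from p15's
`B2Prop31ZeroFieldConcrete.prop31_zeroField_concrete`; one constant `γ₀ = min(a(1 − L⁻²)/(8d + 2m² + 4), 1/16) > 0`
*"dependent on … d and the constant a only"* (here also on `L` and the bound `m²`), for every parameter record `Q` with
`Q.L > 1`, `Q.a > 0`, `Q.d ≥ 1`, every `m² > 0` and error modulus `M ≥ 0`. [cite: Balaban1982Higgs2, Prop. 3.1 (3.26) p.589] -/
theorem prop31Printed_regular (Q : B2.Params) (hQL : 1 < Q.L) (hQa : 0 < Q.a) (hQd : 1 ≤ Q.d) {m2 : ℝ} (hm : 0 < m2)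
    {M : ℝ} (hM : 0 ≤ M) : B2.Prop31Printed Q (regP31Fam Q m2 M) := by
  set γ₀ : ℝ := min (Q.a * (1 - ((Q.L : ℝ) ^ 2)⁻¹) / (8 * Q.d + 2 * m2 + 4)) (1 / 16) with hγ₀
  have hQL' : (1 : ℝ) < Q.L := by exact_mod_cast hQL
  have hQd' : (1 : ℝ) ≤ Q.d := by exact_mod_cast hQd
  have hB0 : 0 < 8 * (Q.d : ℝ) + 2 * m2 + 4 := by linarith
  have hainf0 : 0 < Q.a * (1 - ((Q.L : ℝ) ^ 2)⁻¹) := by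
    have h1 : (1 : ℝ) < (Q.L : ℝ) ^ 2 := by nlinarith
    have : ((Q.L : ℝ) ^ 2)⁻¹ < 1 := inv_lt_one_of_one_lt₀ h1
    exact mul_pos hQa (by linarith)
  have hγpos : 0 < γ₀ := lt_min (div_pos hainf0 hB0) (by norm_num)
  have hγ16 : γ₀ ≤ 1 / 16 := min_le_right _ _
  have hγB : γ₀ * (8 * Q.d + 2 * m2 + 4) ≤ Q.a * (1 - ((Q.L : ℝ) ^ 2)⁻¹) := by
    calc γ₀ * (8 * Q.d + 2 * m2 + 4) ≤ Q.a * (1 - ((Q.L : ℝ) ^ 2)⁻¹) / (8 * Q.d + 2 * m2 + 4) * (8 * Q.d + 2 * m2 + 4) :=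
          mul_le_mul_of_nonneg_right (min_le_left _ _) hB0.le
      _ = Q.a * (1 - ((Q.L : ℝ) ^ 2)⁻¹) := div_mul_cancel₀ _ hB0.ne'
  refine ⟨γ₀, γ₀ * M, hγpos, mul_nonneg hγpos.le hM, fun i hr => ?_, fun i hz => ?_⟩
  · -- the restricted clause
    obtain ⟨hδ, hreg, hsmall, hΦ, hAbs⟩ := hr
    have hL : 1 < i.P.L := by rw [i.hL]; exact hQL
    have hγB' : γ₀ * (8 * i.P.d + 2 * m2 + 4) ≤ Q.a * (1 - ((i.P.L : ℝ) ^ 2)⁻¹) := by rw [i.hd, i.hL]; exact hγB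
    have h := prop31_regular_concrete i.R i.C i.A i.hR i.hK i.hε hQa hL hm hδ hreg hsmall hγpos.le hγB' hγ16 i.Ψ i.Φ hΦ
    simp only [regP31Fam]
    rw [sum_range_natExt, sum_range_natExt, sum_Icc_eq_sum_fin]
    -- the error: `Σ_j err_j ≤ Σ_j C (Lʲ⁺¹ε)^{κ₀} |Λ_{j+1}|`
    have herr : ∑ j : Fin i.K, 64 * γ₀ * (i.P.d : ℝ) ^ 3 * i.C.e ^ 2 * ((i.P.L : ℝ) ^ (j.val + 1)) ^ 2 * i.δ j ^ 2 *
          (i.Ψ j ^ 2 * i.P.mesh (j.val + 1) ^ i.P.d * ((i.R.block j).card : ℝ))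
        ≤ ∑ j : Fin i.K, γ₀ * M * ((Q.L : ℝ) ^ (j.val + 1) * i.P.mesh 0) ^ Q.κ₀ * ((i.vol (j.val + 1) : ℕ) : ℝ) := by
      refine Finset.sum_le_sum fun j _ => ?_
      rw [i.vol_succ j, ← i.hL, ← mesh_eq (j.val + 1)]
      have hc : 0 ≤ ((i.R.block j).card : ℝ) := Nat.cast_nonneg _
      have h1 := mul_le_mul_of_nonneg_right (mul_le_mul_of_nonneg_left (hAbs j) hγpos.le) hc
      have e : 64 * γ₀ * (i.P.d : ℝ) ^ 3 * i.C.e ^ 2 * ((i.P.L : ℝ) ^ (j.val + 1)) ^ 2 * i.δ j ^ 2 *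
            (i.Ψ j ^ 2 * i.P.mesh (j.val + 1) ^ i.P.d * ((i.R.block j).card : ℝ))
          = γ₀ * (64 * (i.P.d : ℝ) ^ 3 * i.C.e ^ 2 * ((i.P.L : ℝ) ^ (j.val + 1)) ^ 2 * i.δ j ^ 2 *
            (i.Ψ j ^ 2 * i.P.mesh (j.val + 1) ^ i.P.d)) * ((i.R.block j).card : ℝ) := by ring
      rw [e]
      calc γ₀ * (64 * (i.P.d : ℝ) ^ 3 * i.C.e ^ 2 * ((i.P.L : ℝ) ^ (j.val + 1)) ^ 2 * i.δ j ^ 2 *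
            (i.Ψ j ^ 2 * i.P.mesh (j.val + 1) ^ i.P.d)) * ((i.R.block j).card : ℝ)
          ≤ γ₀ * (M * i.P.mesh (j.val + 1) ^ Q.κ₀) * ((i.R.block j).card : ℝ) := h1
        _ = γ₀ * M * i.P.mesh (j.val + 1) ^ Q.κ₀ * ((i.R.block j).card : ℝ) := by ring
    have hb : ∀ j : Fin i.K, i.bondKA j = ∑ c : HiggsLattice.PBond i.P (j.val + 1), if Inside (i.R.block j) c then
        i.P.mesh (j.val + 1) ^ i.P.d * ‖covDeriv i.C (barA (j.val + 1) i.A) (extL i.R j (resL i.R j i.Φ)) c‖ ^ 2 else 0 :=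
      fun j => rfl
    simp only [hb]
    linarith [h, herr]
  · -- the zero-field clause
    have hA : i.A = 0 := hz
    have hL : 1 < i.P.L := by rw [i.hL]; exact hQL
    have h0 := prop31_zeroField_concrete i.R i.C i.hR i.hK i.hε hQa hL hm i.Φ
    simp only [regP31Fam]
    rw [sum_range_natExt, sum_range_natExt]
    have hb : ∀ j : Fin i.K, i.bondKA j = bondK i.R j (resL i.R j i.Φ) := by
      intro j
      unfold RMulti.bondKA
      rw [hA]
      exact bondKA_zero i.R i.C j (resL i.R j i.Φ)
    simp only [hb]
    rw [hA]
    -- monotonicity in `γ₀`: `γ₀ ≤ gamma0`, both sums non-negative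
    have hle : γ₀ ≤ gamma0 i.P Q.a m2 := by
      have := gamma0_regular_le_gamma0 (P := i.P) hQa hL hm.le
      rw [i.hd, i.hL] at this
      exact this
    have hbn : 0 ≤ bond0 i.R i.C (0 : HiggsLattice.VecField i.P 0) i.Φ.1 + ∑ j, bondK i.R j (resL i.R j i.Φ) :=
      add_nonneg (bond0_nonneg i.R i.C _ i.Φ.1) (Finset.sum_nonneg fun j _ => bondK_nonneg i.R j _)
    have hmn : 0 ≤ mass0 i.R m2 i.Φ.1 + ∑ j, massK i.R m2 j (resL i.R j i.Φ) :=
      add_nonneg (mass0_nonneg i.R hm.le i.Φ.1) (Finset.sum_nonneg fun j _ => massK_nonneg i.R hm.le j _)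
    have h1 := mul_le_mul_of_nonneg_right hle hbn
    have h2 := mul_le_mul_of_nonneg_right hle hmn
    linarith [h0, h1, h2]

/-! ## §4 `B2.Ineq329Printed` (the per-scale (3.29)) on the concrete general-field family -/

/-- **THE CONCRETE GENERAL-FIELD FAMILY OF `B2.I329Setting`** (one instance per concrete instance `i` and scale `k = j+1`):
`s = Lᵏε`, `massSq = m²`, `restricted` as above, `form = ⟨φ′_k, Δ⁽ᵏ⁾(Bᵏ(Λ_k), Ã^η)φ′_k⟩ = termForm` ((I.2.19)/(3.28)),
`covDiffSq = Σ_{⟨y,y′⟩⊂Λ_k}|U(Ã(⟨y,y′⟩))φ′_k(y′) − φ′_k(y)|² = Σ(Lᵏε)^{d−2}|U(Ã(⟨y,y′⟩))φ_k(y′) − φ_k(y)|²` (`bondKA`, the rescaling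
`φ′_k = (Lᵏε)^{(d−2)/2}φ_k` of p. 590), `l2sq = Σ_{y∈Λ_k}|φ′_k(y)|² = (Lᵏε)⁻²Σ(Lᵏε)^d|φ_k(y)|²`, `vol = |Λ_k|`.
[cite: Balaban1982Higgs2, (3.29) p.590, rescaling p.590] -/
def reg329Fam (Q : B2.Params) (m2 M : ℝ) (ij : Σ i : RMulti Q m2 M, Fin i.K) : B2.I329Setting where
  s := ij.1.P.mesh (ij.2.val + 1)
  massSq := m2
  restricted := ij.1.restricted
  form := termForm ij.1.R ij.1.C Q.a ij.1.A m2 ij.2 (resL ij.1.R ij.2 ij.1.Φ)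
  covDiffSq := ij.1.bondKA ij.2
  l2sq := (ij.1.P.mesh (ij.2.val + 1))⁻¹ ^ 2 *
    ∑ y : LSite ij.1.R ij.2, ij.1.P.mesh (ij.2.val + 1) ^ ij.1.P.d * ‖resL ij.1.R ij.2 ij.1.Φ y‖ ^ 2
  vol := (ij.1.R.block ij.2).card

/-- **THE CELL'S TYPED (3.29) `B2.Ineq329Printed κ₀` HOLDS ON THE CONCRETE GENERAL-FIELD FAMILY** with the exponent `κ₀ = Q.κ₀`
of the parameter record, `γ₀ = min(a(1 − L⁻²)/(8d + 2m² + 4), 1/16)` *"independent of k, Λ_k"* and `C = γ₀M`: every restricted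
instance (regular `Ã ≠ 0` allowed) satisfies `γ₀(covDiffSq + m²s²·l2sq) − C s^{κ₀}|Λ_k| ≤ form` — from
`B2Ineq329RegularField.ineq329_regular_concrete`. [cite: Balaban1982Higgs2, (3.29) p.590] -/
theorem ineq329Printed_regular (Q : B2.Params) (hQL : 1 < Q.L) (hQa : 0 < Q.a) (hQd : 1 ≤ Q.d) {m2 : ℝ} (hm : 0 ≤ m2)
    {M : ℝ} (hM : 0 ≤ M) : B2.Ineq329Printed Q.κ₀ (reg329Fam Q m2 M) := by
  set γ₀ : ℝ := min (Q.a * (1 - ((Q.L : ℝ) ^ 2)⁻¹) / (8 * Q.d + 2 * m2 + 4)) (1 / 16) with hγ₀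
  have hQL' : (1 : ℝ) < Q.L := by exact_mod_cast hQL
  have hQd' : (1 : ℝ) ≤ Q.d := by exact_mod_cast hQd
  have hB0 : 0 < 8 * (Q.d : ℝ) + 2 * m2 + 4 := by linarith
  have hainf0 : 0 < Q.a * (1 - ((Q.L : ℝ) ^ 2)⁻¹) := by
    have h1 : (1 : ℝ) < (Q.L : ℝ) ^ 2 := by nlinarith
    have : ((Q.L : ℝ) ^ 2)⁻¹ < 1 := inv_lt_one_of_one_lt₀ h1
    exact mul_pos hQa (by linarith)
  have hγpos : 0 < γ₀ := lt_min (div_pos hainf0 hB0) (by norm_num)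
  have hγ16 : γ₀ ≤ 1 / 16 := min_le_right _ _
  have hγB : γ₀ * (8 * Q.d + 2 * m2 + 4) ≤ Q.a * (1 - ((Q.L : ℝ) ^ 2)⁻¹) := by
    calc γ₀ * (8 * Q.d + 2 * m2 + 4) ≤ Q.a * (1 - ((Q.L : ℝ) ^ 2)⁻¹) / (8 * Q.d + 2 * m2 + 4) * (8 * Q.d + 2 * m2 + 4) :=
          mul_le_mul_of_nonneg_right (min_le_left _ _) hB0.le
      _ = Q.a * (1 - ((Q.L : ℝ) ^ 2)⁻¹) := div_mul_cancel₀ _ hB0.ne'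
  refine ⟨γ₀, γ₀ * M, hγpos, mul_nonneg hγpos.le hM, fun ij hr => ?_⟩
  obtain ⟨i, j⟩ := ij
  obtain ⟨hδ, hreg, hsmall, hΦ, hAbs⟩ := hr
  have hL : 1 < i.P.L := by rw [i.hL]; exact hQL
  have hγB' : γ₀ * (8 * i.P.d + 2 * m2 + 4) ≤ Q.a * (1 - ((i.P.L : ℝ) ^ 2)⁻¹) := by rw [i.hd, i.hL]; exact hγB
  have hs : i.P.mesh (j.val + 1) ≤ 1 := (mesh_le_mesh (Nat.succ_le_of_lt j.isLt)).trans i.hε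
  have h := ineq329_regular_concrete i.R i.C i.hK hQa hL hm i.A j hs (hδ j) (hreg j) (hsmall j) hγpos.le hγB' hγ16
    (resL i.R j i.Φ)
  have hMψ := l2_le_of_sup i.R j (resL i.R j i.Φ) (hΦ j)
  simp only [reg329Fam]
  -- the mass term: `m² s² · s⁻² Σ s^d|ψ|² = massK`
  have hs0 : i.P.mesh (j.val + 1) ≠ 0 := (i.P.mesh_pos _).ne'
  have hmass : m2 * i.P.mesh (j.val + 1) ^ 2 * ((i.P.mesh (j.val + 1))⁻¹ ^ 2 *
      ∑ y : LSite i.R j, i.P.mesh (j.val + 1) ^ i.P.d * ‖resL i.R j i.Φ y‖ ^ 2) = massK i.R m2 j (resL i.R j i.Φ) := by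
    rw [massK, Finset.mul_sum, Finset.mul_sum]
    refine Finset.sum_congr rfl fun y _ => ?_
    field_simp
  rw [hmass]
  -- the error: `64γ₀d³e²(Lᵏδ)² Σ(Lᵏε)^d|ψ|² ≤ γ₀ M (Lᵏε)^{κ₀} |Λ_k|`
  have hc64 : 0 ≤ 64 * γ₀ * (i.P.d : ℝ) ^ 3 * i.C.e ^ 2 * ((i.P.L : ℝ) ^ (j.val + 1)) ^ 2 * i.δ j ^ 2 := by
    have := hδ j
    positivity
  have e1 := mul_le_mul_of_nonneg_left hMψ hc64
  have e2 := mul_le_mul_of_nonneg_right (mul_le_mul_of_nonneg_left (hAbs j) hγpos.le) (Nat.cast_nonneg (i.R.block j).card)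
  have e3 : 64 * γ₀ * (i.P.d : ℝ) ^ 3 * i.C.e ^ 2 * ((i.P.L : ℝ) ^ (j.val + 1)) ^ 2 * i.δ j ^ 2 *
        (i.Ψ j ^ 2 * i.P.mesh (j.val + 1) ^ i.P.d * ((i.R.block j).card : ℝ))
      = γ₀ * (64 * (i.P.d : ℝ) ^ 3 * i.C.e ^ 2 * ((i.P.L : ℝ) ^ (j.val + 1)) ^ 2 * i.δ j ^ 2 *
        (i.Ψ j ^ 2 * i.P.mesh (j.val + 1) ^ i.P.d)) * ((i.R.block j).card : ℝ) := by ring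
  have hb : i.bondKA j = ∑ c : HiggsLattice.PBond i.P (j.val + 1), if Inside (i.R.block j) c then
      i.P.mesh (j.val + 1) ^ i.P.d * ‖covDeriv i.C (barA (j.val + 1) i.A) (extL i.R j (resL i.R j i.Φ)) c‖ ^ 2 else 0 := rfl
  rw [hb]
  linarith [h, e1, e2, e3]

end Literature.MathematicalPhysics.QuantumFieldTheory.Balaban1983to89.B2Prop31RegularFamily

end
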